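import Literature.Combinatorics.Optimization.EquivariantPsdStructure
import Literature.Combinatorics.Optimization.MatchingInvariantSubspaces
import Literature.Combinatorics.Optimization.MatchingFunctionDegree
import Literature.Computability.Complexity.MatchingEffectiveDerivation
import Literature.Computability.Complexity.MatchingOddCutSosDegree
import Literature.Computability.Complexity.Mod2SosDegreeProof
import HarnessLib

/-!
# Equivariant psd lifts of the perfect matching polytope have exponential size

Fawzi–Saunderson–Parrilo (*Equivariant semidefinite lifts and sum-of-squares hierarchies*,
arXiv:1312.6662 / SIAM J. Optim. 25 (2015)) prove that equivariant psd lifts of regular orbitopes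
are controlled by sums of squares in invariant subspaces (Thm. 1/Thm. 4) and name the matching
polytope as the natural open example (§6, p. 20); Braun–Brown-Cohen–Huq–Pokutta–Raghavendra–Roy–
Weitz–Zink (*The matching problem has no small symmetric SDP*, Math. Program. 165 (2017),
Thm. 1.1/4.10) show that symmetric SDP relaxations of the matching problem need size `2^{Ω(n)}`,
through Thm. 4.9 (effective derivations), §4.5 (restriction of odd-cut certificates to `MOD 2`)
and Grigoriev's degree lower bound for `MOD 2` (Theoret. Comput. Sci. 259 (2001), Cor. 2).

This file composes the tree's theorems into the statement of the cell pnp-psdrank's rung leaf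
`Summit.PneNP.MatchingPsdRank.MatchingEquivariantPsdBound` (an FSP-equivariant psd factorization
of the odd-cut slack matrix of `P_PM(K_n)` — `A(σ·M) = ρ(σ) A(M) ρ(σ)ᵀ` for an arbitrary real
representation `ρ` of `𝔖ₙ` — has size `d ≥ 2^{αn}`), unfolded: `matchingEquivariantPsdBound`.
The composition (`k := ⌊log₂ d²⌋ + 1`, `α := min (1/16) (c/4)`) is the cell's route glue
(HOME/pnp-psdrank-p2/route-R2/glue.lean, deciding theorem `closes` of route `EquivariantThetaLift`,
authored by pnp-psdrank-p2), with its four hypotheses discharged by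
`equivariantStructureSq` (FSP Thm. 1 at the factorization level), `invariantSubspaceLowDegree`
(low-dimensional invariant subspaces are low-degree), `Mod2.matchingEffectiveDerivationV`
(BBCHPRRWZ Thm. 4.9) and `Grigoriev2001_mod2Degree_holds` (Grigoriev 2001, Cor. 2).

## References

* H. Fawzi, J. Saunderson, P. A. Parrilo, arXiv:1312.6662, Thm. 1 (p. 3), §6 (p. 20). [FawziSaundersonParrilo2013]
* G. Braun et al., Math. Program. 165 (2017) 643–662, Thm. 4.10 (p. 10) and §4.5. [BraunEtAl2016]
* D. Grigoriev, Theoret. Comput. Sci. 259 (2001) 613–622, Cor. 2. [Grigoriev2001TCS]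
-/

noncomputable section

open Finset
open scoped BigOperators

namespace Literature.Combinatorics.Optimization

open Literature.Computability.Complexity Literature.Barriers.PneNP

/-- The odd-cut slack polynomial evaluates to the odd-cut slack on a perfect matching.
[cite: BraunEtAl2016, §4.1 (p. 8)] -/
theorem eval_cutPoly_edgeIndicator {n : ℕ} (U : Finset (Fin n)) {M : Finset (Sym2 (Fin n))}
    (hM : IsPMOn (Finset.univ : Finset (Fin n)) M) :
    MvPolynomial.eval (edgeIndicator M) (cutPoly U) = pmSlack U M := by
  classical
  unfold cutPoly pmSlack edgeIndicator
  simp only [map_sub, map_sum, MvPolynomial.eval_X, map_one]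
  congr 1
  rw [Finset.sum_boole, Finset.filter_filter]
  congr 1
  apply Finset.card_bij (fun (e : KnEdge n) _ => (e.1 : Sym2 (Fin n)))
  · intro e he
    simp only [Finset.mem_filter, Finset.mem_univ, true_and] at he
    exact Finset.mem_filter.mpr ⟨he.2, he.1⟩
  · intro e₁ _ e₂ _ h
    exact Subtype.ext h
  · intro e he
    rw [Finset.mem_filter] at he
    exact ⟨⟨e, hM.2.1 e he.1⟩, by simpa [Finset.mem_filter] using ⟨he.2, he.1⟩, rfl⟩

/-- `deg (x(δ(U)) - 1) ≤ 1`. [cite: BraunEtAl2016, §4.5 (p. 10)] -/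
theorem totalDegree_cutPoly_le {n : ℕ} (U : Finset (Fin n)) : (cutPoly U).totalDegree ≤ 1 := by
  unfold cutPoly
  refine le_trans (MvPolynomial.totalDegree_sub _ _) (max_le ?_ (by simp))
  refine le_trans (MvPolynomial.totalDegree_finsetSum _ _) (Finset.sup_le fun e _ => ?_)
  exact (MvPolynomial.totalDegree_X (R := ℝ) e).le

/-- **Theorem A (equivariant psd lifts are theta bodies)**: an equivariant psd factorization of
size `d`, `d² < 2^k`, `4k + 2 ≤ n`, writes every odd-cut slack as a sum of squares of functions of
degree `≤ k`. [cite: FawziSaundersonParrilo2013, Thm. 1 (p. 3) and Thm. 4] -/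
theorem sos_of_equivariantPsdFactorization (n k d : ℕ) (hn : Even n) (hk : 4 * k + 2 ≤ n)
    (hd : d ^ 2 < 2 ^ k) (hfac : HasEquivariantPsdFactorization n d) :
    ∀ U : Finset (Fin n), Odd U.card → ∃ (s : ℕ) (g : Fin s → (PMSol n → ℝ)),
      (∀ j, g j ∈ polLE n k) ∧ ∀ M : PMSol n, pmSlack U M.1 = ∑ j, (g j M) ^ 2 := by
  intro U hU
  obtain ⟨ρ, A, B, hρAB⟩ := hfac
  obtain ⟨V, hVinv, hVdim, hVsq⟩ := equivariantStructureSq n d ρ A B hρAB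
  have hVle : V ≤ polLE n k := invariantSubspaceLowDegree n k hn hk V hVinv (lt_of_le_of_lt hVdim hd)
  obtain ⟨s, g, hgV, hgsum⟩ := hVsq U hU
  exact ⟨s, g, fun j => hVle (hgV j), hgsum⟩

/-- **Theorem B (the theta rank of the perfect matching polytope is linear)**: if every odd-cut
slack of `K_n` is a sum of squares of functions of degree `≤ k`, then `c·n ≤ k` for large even `n`.
[cite: BraunEtAl2016, Thm. 4.10 (p. 10) with §4.5] [cite: Grigoriev2001TCS, Cor. 2] -/
theorem thetaRank_linear :
    ∃ c : ℝ, 0 < c ∧ ∃ n₀ : ℕ, ∀ n : ℕ, n₀ ≤ n → Even n → ∀ k : ℕ,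
      (∀ U : Finset (Fin n), Odd U.card → ∃ (s : ℕ) (g : Fin s → (PMSol n → ℝ)),
          (∀ j, g j ∈ polLE n k) ∧ ∀ M : PMSol n, pmSlack U M.1 = ∑ j, (g j M) ^ 2) →
        c * n ≤ k := by
  classical
  -- for even `n ≥ 2` there is an odd `m` with `n - 2 ≤ 2m ≤ n`
  have exists_odd_half : ∀ {n : ℕ}, Even n → 2 ≤ n → ∃ m : ℕ, Odd m ∧ 2 * m ≤ n ∧ n ≤ 2 * m + 2 := by
    intro n hn h2
    obtain ⟨a, rfl⟩ := hn
    rcases Nat.even_or_odd a with ha | ha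
    · obtain ⟨b, rfl⟩ := ha
      exact ⟨b + b - 1, ⟨b - 1, by omega⟩, by omega, by omega⟩
    · exact ⟨a, ha, by omega, by omega⟩
  obtain ⟨c, hc, n₀, hG⟩ := Grigoriev2001_mod2Degree_holds
  refine ⟨c / 16, by positivity, max (2 * n₀ + 4) (⌈8 / c⌉₊ + 4), ?_⟩
  intro n hn heven k hsos
  have hn₀ : 2 * n₀ + 4 ≤ n := le_trans (le_max_left _ _) hn
  have hn8 : ⌈8 / c⌉₊ + 4 ≤ n := le_trans (le_max_right _ _) hn
  have hcn : 8 + 4 * c ≤ c * n := by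
    have h8c : (8 / c : ℝ) ≤ (n : ℝ) - 4 := by
      have h1 : (8 / c : ℝ) ≤ ⌈8 / c⌉₊ := Nat.le_ceil _
      have h2 : ((⌈8 / c⌉₊ : ℕ) : ℝ) + 4 ≤ n := by exact_mod_cast hn8
      linarith
    have : c * (8 / c) = 8 := by field_simp
    nlinarith [mul_le_mul_of_nonneg_left h8c hc.le]
  -- an odd vertex set `U` with `|U| ∈ {n/2 - 1, n/2}`
  obtain ⟨m, hmodd, hmle, hmge⟩ := exists_odd_half heven (by omega)
  obtain ⟨U, -, hUcard⟩ := Finset.exists_subset_card_eq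
    (show m ≤ (Finset.univ : Finset (Fin n)).card by simp; omega)
  have hUodd : Odd U.card := hUcard ▸ hmodd
  obtain ⟨s, g, hg, hsum⟩ := hsos U hUodd
  -- lift the squares to polynomials of degree ≤ k (T-D.4)
  choose G hGdeg hGeval using fun j => polLELift n k (g j) (hg j)
  set F : MvPolynomial (KnEdge n) ℝ := cutPoly U - ∑ j, G j * G j with hF
  have hFvan : ∀ M : Finset (Sym2 (Fin n)), IsPMOn Finset.univ M →
      MvPolynomial.eval (edgeIndicator M) F = 0 := by
    intro M hM
    simp only [hF, map_sub, map_sum, map_mul, eval_cutPoly_edgeIndicator U hM, hsum ⟨M, hM⟩]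
    rw [sub_eq_zero]
    refine Finset.sum_congr rfl fun j _ => ?_
    rw [hGeval j ⟨M, hM⟩, pow_two]
  have hFdeg : F.totalDegree ≤ 2 * k + 1 := by
    rw [hF]
    refine le_trans (MvPolynomial.totalDegree_sub _ _) (max_le ?_ ?_)
    · exact le_trans (totalDegree_cutPoly_le U) (by omega)
    · refine le_trans (MvPolynomial.totalDegree_finsetSum _ _) (Finset.sup_le fun j _ => ?_)
      refine le_trans (MvPolynomial.totalDegree_mul _ _) ?_
      have := hGdeg j
      omega
  -- effective derivation of the defect (BBCHPRRWZ Thm 4.9)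
  obtain ⟨g', hg'deg, hg'sum⟩ := Mod2.matchingEffectiveDerivationV n heven F hFvan
  -- an SOS certificate of half-degree `2k+1` for the odd-cut slack
  have hcert : HasSOSCertificate (Mod2.system n) (cutPoly U) (2 * k + 1) := by
    refine ⟨s, G, g', fun j => le_trans (hGdeg j) (by omega),
      fun e => le_trans (hg'deg e) (by omega), ?_⟩
    rw [hg'sum, hF]
    abel
  -- restriction to `K_{|U|}` (BBCHPRRWZ §4.5) and Grigoriev
  have href : HasSOSRefutation (Mod2.system U.card) (2 * k + 1) :=
    oddCutRestriction n heven U hUodd (by rw [hUcard]; exact hmle) (2 * k + 1) hcert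
  have hGr := hG U.card (by rw [hUcard]; omega) (2 * k + 1) href
  rw [hUcard] at hGr
  push_cast at hGr
  have hmr : (n : ℝ) ≤ 2 * m + 2 := by exact_mod_cast hmge
  nlinarith [hmr, hGr, hcn, hc]

/-- **Equivariant psd lifts of the perfect matching polytope have size `2^{Ω(n)}`** (the cell's
rung leaf `Summit.PneNP.MatchingPsdRank.MatchingEquivariantPsdBound`, unfolded; route glue
`EquivariantThetaLift.closes` by pnp-psdrank-p2 with all four hypotheses discharged): there are
`α > 0` and `n₀` such that for even `n ≥ n₀` every `𝔖ₙ`-equivariant psd factorization (in the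
sense of Fawzi–Saunderson–Parrilo, arbitrary real representation on the matching side) of the
odd-cut slack matrix of `P_PM(K_n)` has size `d ≥ 2^{αn}`.
[cite: FawziSaundersonParrilo2013, Thm. 1 (p. 3) and §6 (p. 20)] [cite: BraunEtAl2016, Thm. 4.10 (p. 10)] -/
theorem matchingEquivariantPsdBound :
    ∃ α : ℝ, 0 < α ∧ ∃ n₀ : ℕ, ∀ n : ℕ, n₀ ≤ n → Even n → ∀ d : ℕ,
      HasEquivariantPsdFactorization n d → (2 : ℝ) ^ (α * n) ≤ d := by
  classical
  obtain ⟨c, hc, n₁, hB⟩ := thetaRank_linear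
  refine ⟨min (1 / 16) (c / 4), lt_min (by norm_num) (by positivity), max n₁ (max 10 ⌈2 / c⌉₊), ?_⟩
  intro n hn heven d hfac
  have hn₁ : n₁ ≤ n := le_trans (le_max_left _ _) hn
  have h10 : 10 ≤ n := le_trans (le_trans (le_max_left _ _) (le_max_right _ _)) hn
  have hNc : ⌈2 / c⌉₊ ≤ n := le_trans (le_trans (le_max_right _ _) (le_max_right _ _)) hn
  have hcn : 2 ≤ c * n := by
    have h2c : (2 / c : ℝ) ≤ n := le_trans (Nat.le_ceil _) (by exact_mod_cast hNc)
    have : c * (2 / c) = 2 := by field_simp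
    nlinarith [mul_le_mul_of_nonneg_left h2c hc.le]
  set α : ℝ := min (1 / 16) (c / 4) with hα
  have hα16 : α ≤ 1 / 16 := min_le_left _ _
  have hαc : α ≤ c / 4 := min_le_right _ _
  have hαpos : 0 < α := lt_min (by norm_num) (by positivity)
  have hn0 : (0 : ℝ) ≤ n := Nat.cast_nonneg n
  have h10' : (10 : ℝ) ≤ n := by exact_mod_cast h10
  set L : ℕ := Nat.log 2 (d ^ 2) with hL
  have hdlt : d ^ 2 < 2 ^ (L + 1) := Nat.lt_pow_succ_log_self (by norm_num) _
  -- dichotomy: either `4(L+1)+2 ≤ n` (Theorems A and B apply) or `L` is already large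
  have key : 2 * (α * n) ≤ (L : ℝ) ∧ 1 ≤ d := by
    by_cases hk : 4 * (L + 1) + 2 ≤ n
    · have hsos := sos_of_equivariantPsdFactorization n (L + 1) d heven hk hdlt hfac
      have hB' : c * n ≤ ((L + 1 : ℕ) : ℝ) := hB n hn₁ heven (L + 1) hsos
      push_cast at hB'
      refine ⟨?_, ?_⟩
      · nlinarith [mul_le_mul_of_nonneg_right hαc hn0]
      · by_contra hd0
        push Not at hd0
        have hd : d = 0 := by omega
        have hL0 : L = 0 := by rw [hL, hd]; simp
        rw [hL0] at hB'
        push_cast at hB'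
        linarith
    · push Not at hk
      have hkr : (n : ℝ) ≤ 4 * L + 5 := by exact_mod_cast (by omega : n ≤ 4 * L + 5)
      refine ⟨?_, ?_⟩
      · nlinarith [mul_le_mul_of_nonneg_right hα16 hn0]
      · by_contra hd0
        push Not at hd0
        have hd : d = 0 := by omega
        have hL0 : L = 0 := by rw [hL, hd]; simp
        omega
  obtain ⟨hαL, hd1⟩ := key
  have hpow : (2 : ℝ) ^ (L : ℝ) ≤ (d : ℝ) ^ 2 := by
    rw [Real.rpow_natCast]
    have := Nat.pow_log_le_self 2 (by positivity : d ^ 2 ≠ 0)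
    exact_mod_cast this
  have h2αn : (2 : ℝ) ^ (2 * (α * n)) ≤ (2 : ℝ) ^ (L : ℝ) :=
    Real.rpow_le_rpow_of_exponent_le (by norm_num) hαL
  have hsq : ((2 : ℝ) ^ (α * n)) ^ 2 ≤ (d : ℝ) ^ 2 := by
    have : ((2 : ℝ) ^ (α * n)) ^ 2 = (2 : ℝ) ^ (2 * (α * n)) := by
      rw [← Real.rpow_natCast, ← Real.rpow_mul (by norm_num)]
      push_cast
      ring_nf
    rw [this]
    exact le_trans h2αn hpow
  have hxnn : 0 ≤ (2 : ℝ) ^ (α * n) := by positivity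
  have hdnn : (0 : ℝ) ≤ d := Nat.cast_nonneg d
  exact (pow_le_pow_iff_left₀ hxnn hdnn two_ne_zero).1 hsq

end Literature.Combinatorics.Optimization
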